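import Summits.NavierStokesRegularity.NavierStokesRegularity.Theses.FilamentPinchDoor
import HarnessLib

/-!
# Route `FilamentPinchDoor` — item `Assembly` (stmt-NavierStokesRegularity-26433)

The assembly item of the route records BY NAME the chain
`SuitableHalfSpaceZoom → FilamentaryGrowth → FilamentPinchLiouville → PoloidalWindowRigidity → HalfSpaceWindowDoor.Target`;
it is closed by the route's deciding theorem `FilamentPinchDoor.closes` (planner ns-idea-6 g3).  Prover seat `ns-el-k1b` g0
(director-ns #184 (2a)).  WHAT THIS IS NOT: none of the route's cruxes (26430 `FilamentPinchLiouville`, 26431 `FilamentaryGrowth`,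
19708 `PoloidalWindowRigidity`) nor the support 26432 is proved here; the door leaf and NS regularity stay OPEN.
-/

namespace Summit.NavierStokesRegularity.NavierStokesRegularity.Theorems

-- the problem directory repeats the summit name (`NavierStokesRegularity/NavierStokesRegularity`)
set_option linter.dupNamespace false

/-- **Assembly of route `FilamentPinchDoor` (item stmt-NavierStokesRegularity-26433).**  The four items of the route imply the
half-space window door leaf, by the route's deciding theorem `FilamentPinchDoor.closes`. [folklore] -/
theorem FilamentPinchDoor.Assembly_proof :
    Summit.NavierStokesRegularity.NavierStokesRegularity.Theses.FilamentPinchDoor.Assembly :=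
  fun hZ hF hP hW => Summit.NavierStokesRegularity.NavierStokesRegularity.Theses.FilamentPinchDoor.closes hZ hF hP hW

end Summit.NavierStokesRegularity.NavierStokesRegularity.Theorems
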